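import Literature.NumberTheory.EllipticCurves.ModularCurve
import Literature.NumberTheory.EllipticCurves.GlobalMinimalModel
import Literature.NumberTheory.EllipticCurves.GaloisAction
import Literature.NumberTheory.EllipticCurves.SemistabilityDefect
import Literature.NumberTheory.DiophantineGeometry.Conductor
import Literature.NumberTheory.DiophantineGeometry.TateAlgorithm
import Literature.NumberTheory.DiophantineGeometry.KodairaSymbol
import Mathlib.NumberTheory.Padics.HeightOneSpectrum
import HarnessLib
import HarnessLib.Audit.Tags

/-!
# Candidates E-desc-7 / 8 / 9 / 9♯ / 10: the EISENSTEIN SPLIT of the component-exponent degree law and the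
# teeth it leaves open (`ComponentExponentDegreeLawEisensteinRange`, `ComponentExponentDegreeLawWildResidue`,
# `WildOddStarFourLaw`, `WildOddStarEightLaw`, `TameThreeStarFourLaw`)
# — cell `bsd-f2-manin` (D-0131 (3) frontier: the Manin constant at additive primes). `@[conjecture]`
# leaf (NOTHING asserted; definitions only; the proved split CEL ↔ range ∧ residue and the edges live in
# `ComponentExponentEisensteinEdges.lean`).

HONEST FRAMING. LENS = descent / visibility / component groups (planner `bsd-f2-manin-desc` g1/g2, HOME
`run/shared/lean/pub/bsd-f2-manin/MEMO-desc.md` §17 «Eisenstein sandwich» and §17.9 «teeth»), Props VERBATIM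
from HOME/desc/Sketch-desc-g1.lean (sha16 61107beb94eee554 ⊇ audited cdb5e28549c44781; audited copy
HOME/ref1-C12-desc-g2.lean) with the sketch's `componentGroupExponent` replaced by the tree's
`KodairaSymbol.componentGroupExponent`; binder block = the landed `ComponentExponentDegreeLaw` (globally
minimal `W`, optimal datum `D` at the conductor level: lattice clause + minimal degree for its newform).
THE SPLIT (memo §17): the landed CEL is, clause by clause, the conjunction of E-desc-7 — the clauses at primes
`q` with `q² ∤ N` or `q ≥ 5`, where `Φ_q(J₀(N))` is Eisenstein in print (Ribet 1990 Thm 3.12 for `q ∥ N`;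
Edixhoven 1991 for `q > 3`), so the Eisenstein sandwich `Φ_q(E) → Φ_q(J₀(N)) → Φ_q(E) = [deg φ]` plus
Brauer–Nesbitt proves the clause (inputs in print, deduction the cell's; SUPPORT-grade) — and E-desc-8, the
WILD RESIDUE at `q ∈ {2, 3}` with `q² ∣ N` (exactly the cell's band `4 ∣ N`, `9 ∣ N`), where Eisenstein-ness of
`Φ_q(J₀(N))[ℓ^∞]`, `ℓ ∈ {2, 3}`, is NOT in print. THE TEETH (memo §17.9): inside the residue the `ℓ = 2`,
exponent-2 clauses are in print (Calegari–Emerton 2009 Thm 1, tree fact `calegariEmerton_oddModularDegree`)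
and the `ℓ = 3` clauses are the an leaves `CuspUnipotentDegreeLawAtTwo/AtThree`; OPEN-NEW is the exponent-4
tooth `I_n*`, `n` odd (`Φ ≅ ℤ/4`) at `q ∈ {2, 3}` (E-desc-9 `4 ∣ deg φ₀`, census-sharp E-desc-9♯ `8 ∣ deg φ₀`),
and the one tooth of the landed `SemistabilityDefectDegreeLawFive` beyond CEL: III/III* at `q ≥ 5 ⇒ 4 ∣ deg φ₀`
(E-desc-10). BC5 WITNESS (memo §§7, 17.4, 17.9; HOME/desc/recut23-4e5.txt): residue 0 violations; refuter-1's
engine (§R8): 327 968 irreducible wild-cell incidences, 0 violations; E-desc-10 ≈ 85 expected failures vs 0;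
9♯ true but its named tooth is not load-bearing (the `v₂(deg)` floor is type-free in `v₂(N)`). Refuter
verdicts: REF1 **E-desc-8, 9, 9♯, 10 SURVIVE; E-desc-7 support-grade (A1 clean)** 2026-08-27T17:30Z
(HOME/REFUTER-ref1.md §R8.1–§R8.3, 8/8 BC7 CLEAN); REF2 (HOME/REFUTER-ref2.md / LIT-PLACEMENT v3–v4): E-desc-7
PRINT-IMPLICIT, E-desc-8 ⊂ the CEL split, E-desc-9/9♯ OPEN-NEW (floors: `2 ∣` CE09 in print, `4 ∣ ⟸ EIS23` open,
`8 ∣` no mechanism), E-desc-10 = the SDL₅ split tooth, NOT-IN-PRINT.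
-/

noncomputable section

open scoped MatrixGroups ModularForm

open CongruenceSubgroup WeierstrassCurve
  Literature.NumberTheory.EllipticCurves Literature.NumberTheory.EllipticCurves.ModularForms
  Literature.NumberTheory.DiophantineGeometry

namespace Summit.BirchSwinnertonDyer.Rank1Residual.ManinAdditive

/-- **Candidate E-desc-7 `ComponentExponentDegreeLawEisensteinRange`** — the clauses of CEL at the
primes `q` with `¬ q² ∣ N ∨ 5 ≤ q` (nothing asserted; theorem-sketch in MEMO-desc §17.2).
[cite: Takahashi2001, Thm 2.3 (p. 6, square-free case; the composite-level Eisenstein range is print-implicit — cell bsd-f2-manin MEMO-desc.md §17.2, E-desc-7, support-grade)] -/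
@[conjecture] def ComponentExponentDegreeLawEisensteinRange : Prop :=
  ∀ (W : WeierstrassCurve ℚ) [W.IsElliptic] [W.IsGloballyMinimal] [NeZero (W.conductorNorm ℤ)]
    (D : ModularParametrizationData W (W.conductorNorm ℤ)),
    (∀ z ∈ D.L.lattice, ∃ w ∈ periodLattice D.f, z = D.c * w) →
    (∀ (W' : WeierstrassCurve ℚ) [W'.IsElliptic]
        (D' : ModularParametrizationData W' (W.conductorNorm ℤ)),
        D'.f = D.f → D.modularDegree ≤ D'.modularDegree) →
    ∀ (q : ℕ) (hq : q.Prime), (¬ q ^ 2 ∣ W.conductorNorm ℤ ∨ 5 ≤ q) →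
      ∀ (ℓ : ℕ), ℓ.Prime → W.HasIrreducibleModPGaloisRep ℓ →
      ℓ ^ padicValNat ℓ (W.kodairaSymbolAt ((Rat.HeightOneSpectrum.primesEquiv (R := ℤ)).symm ⟨q, hq⟩)).componentGroupExponent ∣
        D.modularDegree
/-- **Candidate E-desc-8 `ComponentExponentDegreeLawWildResidue`** — the clauses of CEL at the
primes `q < 5` with `q² ∣ N` (i.e. `q ∈ {2,3}` additive: `4 ∣ N` or `9 ∣ N`); nothing asserted;
the cell's frontier residue (MEMO-desc §17.3–17.4).
[cite: CalegariEmerton2008, Theorem 1 (arXiv:math/0503359 p. 2; covers the ℓ = 2 exponent-2 clauses only — the wild residue is NOT in print, cell bsd-f2-manin MEMO-desc.md §17.3–17.4, E-desc-8)] -/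
@[conjecture] def ComponentExponentDegreeLawWildResidue : Prop :=
  ∀ (W : WeierstrassCurve ℚ) [W.IsElliptic] [W.IsGloballyMinimal] [NeZero (W.conductorNorm ℤ)]
    (D : ModularParametrizationData W (W.conductorNorm ℤ)),
    (∀ z ∈ D.L.lattice, ∃ w ∈ periodLattice D.f, z = D.c * w) →
    (∀ (W' : WeierstrassCurve ℚ) [W'.IsElliptic]
        (D' : ModularParametrizationData W' (W.conductorNorm ℤ)),
        D'.f = D.f → D.modularDegree ≤ D'.modularDegree) →
    ∀ (q : ℕ) (hq : q.Prime), q ^ 2 ∣ W.conductorNorm ℤ → q < 5 →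
      ∀ (ℓ : ℕ), ℓ.Prime → W.HasIrreducibleModPGaloisRep ℓ →
      ℓ ^ padicValNat ℓ (W.kodairaSymbolAt ((Rat.HeightOneSpectrum.primesEquiv (R := ℤ)).symm ⟨q, hq⟩)).componentGroupExponent ∣
        D.modularDegree
/-- **Candidate E-desc-9 `WildOddStarFourLaw`** (nothing asserted): optimal `E`, `q ∈ {2,3}`, Kodaira
type `Iₙ*` with `n` odd at `q`, no rational `2`-isogeny (`E[2]` irreducible) ⇒ `4 ∣ deg φ₀`.
[cite: CalegariEmerton2008, Theorem 1 (arXiv:math/0503359 p. 2; gives 2 ∣ deg φ₀ only — the exponent-4 tooth is OPEN-NEW, cell bsd-f2-manin MEMO-desc.md §17.9, E-desc-9)] -/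
@[conjecture] def WildOddStarFourLaw : Prop :=
  ∀ (W : WeierstrassCurve ℚ) [W.IsElliptic] [W.IsGloballyMinimal] [NeZero (W.conductorNorm ℤ)]
    (D : ModularParametrizationData W (W.conductorNorm ℤ)),
    (∀ z ∈ D.L.lattice, ∃ w ∈ periodLattice D.f, z = D.c * w) →
    (∀ (W' : WeierstrassCurve ℚ) [W'.IsElliptic]
        (D' : ModularParametrizationData W' (W.conductorNorm ℤ)),
        D'.f = D.f → D.modularDegree ≤ D'.modularDegree) →
    ∀ (q : ℕ) (hq : q.Prime) (n : ℕ), q < 5 → Odd n →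
      W.kodairaSymbolAt ((Rat.HeightOneSpectrum.primesEquiv (R := ℤ)).symm ⟨q, hq⟩) =
        KodairaSymbol.Istar n →
      W.HasIrreducibleModPGaloisRep 2 → 4 ∣ D.modularDegree
/-- **Candidate E-desc-9♯ `WildOddStarEightLaw`** (nothing asserted; census-sharp form of E-desc-9:
the observed floor of `v₂(deg φ₀)` on this stratum is `3`).
[cite: CalegariEmerton2008, Theorem 1 (arXiv:math/0503359 p. 2; gives 2 ∣ deg φ₀ only — the 8 ∣ deg φ₀ floor is NOT in print, cell bsd-f2-manin MEMO-desc.md §17.9, E-desc-9♯)] -/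
@[conjecture] def WildOddStarEightLaw : Prop :=
  ∀ (W : WeierstrassCurve ℚ) [W.IsElliptic] [W.IsGloballyMinimal] [NeZero (W.conductorNorm ℤ)]
    (D : ModularParametrizationData W (W.conductorNorm ℤ)),
    (∀ z ∈ D.L.lattice, ∃ w ∈ periodLattice D.f, z = D.c * w) →
    (∀ (W' : WeierstrassCurve ℚ) [W'.IsElliptic]
        (D' : ModularParametrizationData W' (W.conductorNorm ℤ)),
        D'.f = D.f → D.modularDegree ≤ D'.modularDegree) →
    ∀ (q : ℕ) (hq : q.Prime) (n : ℕ), q < 5 → Odd n →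
      W.kodairaSymbolAt ((Rat.HeightOneSpectrum.primesEquiv (R := ℤ)).symm ⟨q, hq⟩) =
        KodairaSymbol.Istar n →
      W.HasIrreducibleModPGaloisRep 2 → 8 ∣ D.modularDegree
/-- **Candidate E-desc-10 `TameThreeStarFourLaw`** (nothing asserted): optimal `E`, prime `q ≥ 5`,
Kodaira type `III` or `III*` at `q` (`Φ ≅ ℤ/2`, semistability defect `e_q = 4`), `E[2]` irreducible
⇒ `4 ∣ deg φ₀` — the one clause of `SemistabilityDefectDegreeLawFive` not implied by CEL.
[cite: CalegariEmerton2008, Theorem 1 (arXiv:math/0503359 p. 2; gives 2 ∣ deg φ₀ only — «4 ∣ deg φ₀» for III/III* at q ≥ 5 is NOT in print, cell bsd-f2-manin MEMO-desc.md §17.9, E-desc-10)] -/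
@[conjecture] def TameThreeStarFourLaw : Prop :=
  ∀ (W : WeierstrassCurve ℚ) [W.IsElliptic] [W.IsGloballyMinimal] [NeZero (W.conductorNorm ℤ)]
    (D : ModularParametrizationData W (W.conductorNorm ℤ)),
    (∀ z ∈ D.L.lattice, ∃ w ∈ periodLattice D.f, z = D.c * w) →
    (∀ (W' : WeierstrassCurve ℚ) [W'.IsElliptic]
        (D' : ModularParametrizationData W' (W.conductorNorm ℤ)),
        D'.f = D.f → D.modularDegree ≤ D'.modularDegree) →
    ∀ (q : ℕ) (hq : q.Prime), 5 ≤ q →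
      (W.kodairaSymbolAt ((Rat.HeightOneSpectrum.primesEquiv (R := ℤ)).symm ⟨q, hq⟩) =
          KodairaSymbol.III ∨
        W.kodairaSymbolAt ((Rat.HeightOneSpectrum.primesEquiv (R := ℤ)).symm ⟨q, hq⟩) =
          KodairaSymbol.IIIstar) →
      W.HasIrreducibleModPGaloisRep 2 → 4 ∣ D.modularDegree
end Summit.BirchSwinnertonDyer.Rank1Residual.ManinAdditive

end
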